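import Summits.QuantumFields.YangMills.Theorems.BalabanUVNodesN08SlotOfRecordFromAlphaACMassBound

/-!
# BalabanUVNodes ∕ N08 — THE HISTORY-EXTENSIVE MASS LETTER, I: the large-field row B25 (pp. 273–274) for an AC tower under
# `m_k(h,U) ≤ exp(c_m|T₁^{(k)}| + Σ_{j<k} a_j·|Z_j(h)|)` — the past large-field fibre volumes are PAID BY THE PRINTED Z-TERMS «Σ_j O(log g_j⁻¹)|Z_j|» of (41),
# inside their slack `a_j ≤ A·x(g_j) − zcoef_j`; at the record's own booking that slack is `≥ c₁·d(𝔤)`, uniformly in `j`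

Track A, DAG node N08 = T. Bałaban, CMP **102** (1985) 255–275 [Balaban1985UV3]: Thm 1 p. 257 (bounds (5)), (41) p. 266 («+ Σ_{j=0}^{k−1} O(log g_j⁻¹)|Z_j|»), (39) p. 266,
(67)–(71) pp. 273–274 («The analysis of Sect. 3.C [9], which is model independent, show that these small factors are enough to control all sums in (41) …»).  Cell `pub-ymgap`,
width seat `pub-ymgap-dag-n08-w1` (g5), W-SEAT-START-LIST §n08 item 1 successor piece (o18) = file 23; `--supports` K1⁹ `StabilityBRunRowsAtRecordR13SepCoPHV` (stmt-QuantumFields-27364, KEY MAP v2; helper).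
Companion of file 15 (`…N08SlotOfRecordFromAlphaACMassBound`: B25 under the UNIFORM letter `m_k(h,U) ≤ exp(c_m|T₁^{(k)}|)`, `d` re-booked `d + c_m`).

THE POINT (answer, in the kernel, to the question put to this lineage by n08-w3 g4, `…HaarCompatibilityGuardKStepMasses` §8(b): «the located `hmass` letter may need the
history structure rather than a density bound on the transport alone»).  The UNIFORM letter asks the iterated Radon–Nikodym transports of [Balaban1985Averaging] (15) to be
`≤ e^{c_m|T₁^{(k)}|}` at level `k` whatever the history — and per-level fibre-volume bounds STACK (`…GuardKStepMasses`: `Σ_{j<k} #PBond(j+1)` is extensive in the FIRST coarse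
lattice).  But in (41) every history `h` carries, at EVERY later level `k`, the printed Z-terms `Zterm k h = Σ_{j<k} zcoef_j·|Z_j(h)|` of ALL its past large-field regions, and the
lane books `zcoef_j ≤ A·x(g_j)` with room to spare.  This file proves that a mass excess which is EXTENSIVE IN THE HISTORY'S OWN PAST LARGE-FIELD VOLUMES,
`m_k(h,U) ≤ exp(c_m|T₁^{(k)}| + Σ_{j<k} a_j|Z_j(h)|)` with `zcoef_j + a_j ≤ A·x(g_j)`, costs B25 NOTHING beyond file 15's `d ↦ d + c_m`: the excess of level `j` is charged
to the Z-term of level `j`, which the history keeps for ever — print's own mechanism (p. 274), no «no-stacking» structure needed on the large-field regions.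

WHAT THIS FILE PROVES (kernel; theorems only, 0 def; nothing of the paper asserted).
* §1 ★★★ `lf_towerAC3_of_massBoundZ` — **ROW B25 FOR AN AC TOWER INPUT `D : TowerAC.TowerInputAC S G` UNDER THE HISTORY-EXTENSIVE MASS BOUND**
  `m_k(h,U) ≤ exp(c_m|T₁^{(k)}| + Σ_{j<k} a_j·|Z_j(h)|)` (`1 ≤ k ≤ K`; `c_m, a_j ≥ 0`; masses vanish off admissible histories), from exactly the hypotheses of the lane's
  `LiftBridge.lf_tower3_avg` with the Z-rate hypothesis read WITH THE BUDGET, `zcoef_j + a_j ≤ A·x(g_j)`: `LF_k(U)[−(1/g_k²)A(U_k(h,U)) + Zterm_k(h)] ≤ exp((d + c_m)|T₁^{(k)}|)`.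
  MECHANISM (file 15's device, one more coordinate): the std `Carriers.TowerInput` with the CAPPED masses `e^{−c_m|T₁^{(k)}| − Σ_{j<k} a_j|Z_j(h)|}·m_k(h,·)` (`≤ 1`) AND THE
  SHIFTED Z-COEFFICIENTS `zcoef_j + a_j` over the same averaging, minimisers, regions; the lane's chain runs on it VERBATIM; its functional at its own Z-terms IS
  `e^{−c_m|T₁^{(k)}|}·LF_k(U)[−mainT + Zterm]` of `D` — the history-dependent parts cancel EXACTLY, summand by summand (`Zterm′_k(h) = Zterm_k(h) + Σ_{j<k} a_j|Z_j(h)|`).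
* §2 ★★ `bookedCZ_add_le_xlog`, `zcoefOf_add_le` — **THE RECORD'S BOOKING HAS THE BUDGET**: for the lane's booked coefficients `zcoef_j = (Cz + Cv)g_j + C₅ + C₆ + (|log σ₀| +
  d(𝔤)·log g_j⁻¹)·c₁` (`Carriers.zcoefOf`) and its rate constant `A = (Cz + Cv) + C₅ + C₆ + (|log σ₀| + d(𝔤))·c₁` (`LargeFieldStd.zcoefOf_le`):
  **`zcoef_j + d(𝔤)·c₁ ≤ A·x(g_j)` for every `j < K`** — a uniform budget `a_j := d(𝔤)·c₁` (`= 3·d(𝔤)` at the record's `c₁ = 3`; real arithmetic, `x(g) = 1 + log g⁻¹ ≥ 1`);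
  `zcoefOf_slack_eq` displays the whole slack `A·x(g_j) − zcoef_j = (Cz + Cv)(1 − g_j) + d(𝔤)c₁ + [(Cz + Cv) + C₅ + C₆ + |log σ₀|c₁]·log g_j⁻¹` (it GROWS like `log g_j⁻¹` at fine levels).
* §3 ★★ `lf_towerOfAC_of_alphaAC_of_massBoundZ` — **B25 AT THE LANE'S AC TOWER `towerOfAC 𝔠.lane X 𝔖` on the `≤`-family FROM THE (α)-AC ROWS AND THE HISTORY-EXTENSIVE BOUND
  `m_k(h,U) ≤ exp(c_m|T₁^{(k)}| + d(𝔤)c₁·Σ_{j<k}|Z_j(h)|)`, ALL PROVISOS OF RECORD UNCHANGED** (`prov_hb₁`∕`prov_hb₂` at the record's `A`, `b₀`: the budget lives inside the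
  booking, not in the provisos) — file 15 §2's twin.

LOCATED READING (R4⁷) (count-neutral; owners — plan ∕ node00-def ∕ pub-balaban3d ∕ the n08-w3∕w6 analysis lineage — decide): N08's mass letter MAY BE HISTORY-EXTENSIVE.
The a.e. analytic target (a) of `N08-VERSION-CAVEAT-DISSOLVED.md` becomes: «`massRecAC … (avOfPrint N S) k h ≤ exp(c_m|T₁^{(k)}| + c₁d(𝔤)·Σ_{j<k}|Z_j(h)|)` `dU_k`-a.e.» (file 24
carries it to the slot through the re-massed tower).  For the per-level analysis this SPLITS the transport of level `j`: over the history's large-field region `Z_j(h)` a fibre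
volume `≤ e^{a|Z_j(h)|}` per level suffices — REGION-LOCAL, NO STACKING QUESTION (each level's excess is charged to that level's own Z-term, `a = c₁d(𝔤)`, more at fine levels);
only the complement (where the step weights impose nothing and the input is the transported reference measure itself) must stay inside the uniform `c_m|T₁^{(k)}|` — the pure
iterated-Haar-push-forward question, the cleanest form of n08-w3's §4 «no-stacking» mechanism.  Nothing here decides either part.

HONEST FRAMING: count-neutral helper; the (α)-AC rows and the mass bound are HYPOTHESES = N08's object gap in AC currency; `PrintedUV3V` NOT proved; N08 NOT discharged;
E6′ neither used nor decided; one finite 𝕋⁴ programme at fixed ε, Bałaban AS PRINTED (d = 3 tori of [B10] inside the record) — R4 closes the conditional finite-𝕋⁴ rung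
`BalabanLadder.UV` only; the Yang–Mills mass gap (Clay) is NOT proved by any of this; nothing continuum ∕ ℝ⁴ ∕ OS.  No `sorry`, standard axioms.
-/

noncomputable section

namespace Summit.QuantumFields.YangMills.BalabanUVNodes.N08LargeFieldRowZBudget

open scoped Matrix.Norms.L2Operator
open Literature.MathematicalPhysics.QuantumFieldTheory.Balaban1983to89
open Literature.MathematicalPhysics.QuantumFieldTheory.Balaban1983to89.B10 (TowerRun pFun)
open Literature.MathematicalPhysics.QuantumFieldTheory.Balaban1985CMP102
open Literature.MathematicalPhysics.QuantumFieldTheory.Balaban1985CMP102.Setting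
open Summit.QuantumFields.Balaban3D
open Summit.QuantumFields.Balaban3D.Carriers (nblkOf StepSeries Hist HistWeights TowerInput CarrierConsts ZVol zcoefOf rcolOf eps1Of epsSOf)
open Summit.QuantumFields.Balaban3D.Proofs
open Summit.QuantumFields.Balaban3D.Proofs.ScalesArithmetic
open Summit.QuantumFields.Balaban3D.Proofs.Constants (eps0Of consts3_d_eq_log)
open Summit.QuantumFields.Balaban3D.Proofs.FamilyLE (le_of_eps0Of thresholds_of_le)
open Summit.QuantumFields.Balaban3D.Proofs.Family (prov_hb₁ prov_hb₂)
open Summit.QuantumFields.Balaban3D.Proofs.GroupModelLieC (lieC)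
open Summit.QuantumFields.Balaban3D.Proofs.TowerAC (TowerInputAC LFAC)
open Summit.QuantumFields.Balaban3D.Proofs.StandardAC (ExternalInputsAC)
open Summit.QuantumFields.Balaban3D.Proofs.InputsAC (inputOfAC towerOfAC)
open Summit.QuantumFields.Balaban3D.Proofs.AlphaAC (AlphaDataAC RunAlphaAC)
open Summit.QuantumFields.Balaban3D.Proofs.Thresholds (gamma71L)
open Summit.QuantumFields.Balaban3D.Proofs.LiftBridge (liftCfg lf_tower3_avg)
open Summit.QuantumFields.Balaban3D.Proofs.Run3SmallFactors (codeZ)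
open Summit.QuantumFields.Balaban3D.Proofs.LargeFieldKnit (bookedCZ_le_xlog)
open B7Prop1Explicit (hol plaqWord)
open B7Prop1Local (pdevOn loK plaqHiK)
open B7Prop2Explicit (avgIter)
open B10LargeField (xlog one_le_xlog)

/-! ## §1 Row B25 for an AC tower input under the history-extensive mass bound: the lane's chain on capped masses and shifted Z-coefficients -/
section Generic

variable {L : ℕ} {S : Scales L} {G : Type} [GaugeGroup G] [MeasurableSpace G] [HaarData G]

/-- ★★★ **`B10Assembly.LeafSystem.lf` FOR AN AC TOWER INPUT UNDER THE HISTORY-EXTENSIVE MASS BOUND** — pp. 273–274 («… these small factors are enough to control all sums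
in (41) …») with the Z-terms of (41) «+ Σ_{j=0}^{k−1} O(log g_j⁻¹)|Z_j|» paying for the history's past fibre volumes: for `D : TowerAC.TowerInputAC S G` (masses `≥ 0`, NOT
capped) with `m_k(h,U) ≤ exp(c_m·|T₁^{(k)}| + Σ_{j<k} a_j·|Z_j(h)|)` for `1 ≤ k ≤ K` (`c_m ≥ 0`, `a_j ≥ 0`), vanishing off admissible histories, the hypotheses of
`LiftBridge.lf_tower3_avg` verbatim EXCEPT that the Z-rate is read with the budget, `zcoef_j + a_j ≤ A·x(g_j)` (`j < K`) — one gets, for the constants `C` (`C.d = 6∕log L`),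
`LF_k(U)[−(1/g_k²)A(U_k(h,U)) + Σ_{j<k} zcoef_j|Z_j(h)|] ≤ exp((C.d + c_m)·|T₁^{(k)}|)` for every `k ≤ K`.  Proof: the std tower input with capped masses
`e^{−c_m|T₁^{(k)}| − Σ_{j<k} a_j|Z_j(h)|}·m_k(h,·)` and Z-coefficients `zcoef_j + a_j` satisfies `lf_tower3_avg`, and its functional at its own Z-terms equals
`e^{−c_m|T₁^{(k)}|}·LF_k(U)[−mainT + Zterm]` of `D`, summand by summand. [cite: Balaban1985UV3, pp.273–274 + (67)–(68) p.273 + (39)–(41) p.266] -/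
theorem lf_towerAC3_of_massBoundZ (𝔊 : GroupModel G) (C : B10Assembly.Consts) (hd : C.d = 6 / Real.log C.L) (hCL : C.L = (L : ℝ))
    (hL : 2 ≤ L) (D : TowerInputAC S G) {ρ' r₀ A gs ε C₁ cm : ℝ} (a : ℕ → ℝ)
    (hsites : ∀ k, k ≤ S.K → S.sites k = (Fintype.card (Site S.P k) : ℝ))
    (hW : ∀ (k : ℕ) (h : Hist S.P k) (U : GaugeField S.P k G), ¬ Hist.Admissible D.M₁ D.Rcol k h → D.W.mass k h U = 0)
    (hcm : 0 ≤ cm) (ha : ∀ j, 0 ≤ a j)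
    (hmass : ∀ k, 1 ≤ k → k ≤ S.K → ∀ (h : Hist S.P k) (U : GaugeField S.P k G),
      D.W.mass k h U ≤ Real.exp (cm * S.sites k + ∑ j ∈ Finset.range k, a j * (ZVol D.M₁ D.Rcol k h j : ℝ)))
    (hε : 0 < ε) (hC₁ : 0 < C₁) (hb₀ : 0 < D.b₀) (hp₀ : 0 < D.p₀)
    (hrun : ∀ j, S.gk j = B10.gRun C.g C.L ε j)
    (hγ : ∀ j, j < S.K → S.gk j ≤ gamma71L C₁ L D.b₀ D.p₀)
    (hLF67 : ∀ k, k ≤ S.K → ∀ (h : Hist S.P k), Hist.Admissible D.M₁ D.Rcol k h → ∀ (U : GaugeField S.P k G),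
      ∀ e ∈ Hist.disc h, S.gk e.1 * B10.pFun D.b₀ D.p₀ (S.gk e.1) ≤
        ‖((hol (avgIter L (liftCfg 𝔊 (D.UkH k h U)) e.1) (codeZ e) (plaqWord e.2.2.1 e.2.2.2) :
            (Matrix (Fin 𝔊.N) (Fin 𝔊.N) ℂ)ˣ) : Matrix (Fin 𝔊.N) (Fin 𝔊.N) ℂ) - 1‖)
    (h68 : ∀ k, k ≤ S.K → ∀ (h : Hist S.P k), Hist.Admissible D.M₁ D.Rcol k h → ∀ (U : GaugeField S.P k G),
      ∀ e ∈ Hist.disc h,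
        pdevOn (loK L e.1 (codeZ e)) (plaqHiK L e.1 (codeZ e) e.2.2.1 e.2.2.2) (liftCfg 𝔊 (D.UkH k h U)) <
          C₁ * (S.gk e.1 * B10.pFun D.b₀ D.p₀ (S.gk e.1)) * (((L : ℝ) ^ e.1)⁻¹) ^ 2)
    (hM : 0 < D.M₁) (hRcol : ∀ i j, i ≤ j → j ≤ S.K → D.Rcol j ≤ D.Rcol i) (hρ : 0 ≤ ρ') (hr : 0 ≤ r₀)
    (hRle : ∀ i, i ≤ S.K → (D.Rcol i : ℝ) ≤ ρ' * xlog (S.gk i) ^ r₀)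
    (hz0 : ∀ j, j < S.K → 0 ≤ D.zcoef j) (hz : ∀ j, j < S.K → D.zcoef j + a j ≤ A * xlog (S.gk j))
    (hA : 0 ≤ A)
    (hg : ∀ j, j ≤ S.K → 0 < S.gk j ∧ S.gk j ≤ gs) (hgs : gs ≤ 1)
    (hp : r₀ * 3 + 2 ≤ 2 * D.p₀)
    (hb₁ : 8 * (A * (2 * (2 * ρ' + 2 * ((L : ℝ) * (3 * ((D.M₁ : ℝ) - 1)) + 3 * ((L : ℝ) - 1)) + 20) * 1) ^ 3 /
      (Real.log C.L / 2)) ≤ 1 / (4 * (𝔊.N : ℝ)) * D.b₀ ^ 2)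
    (hb₂ : 56 ≤ 1 / (4 * (𝔊.N : ℝ)) * D.b₀ ^ 2) :
    ∀ k, k ≤ D.tower3.toTowerRun.K → ∀ U : D.tower3.toTowerRun.Cfg k,
      D.tower3.toTowerRun.LF k U (fun h => -(D.tower3.toTowerRun.mainT k h U) + D.tower3.toTowerRun.Zterm k h) ≤
        Real.exp ((C.d + cm) * D.tower3.toTowerRun.sites k) := by
  classical
  -- the scale profile: `0` at `k = 0` (there `m_0 = 1` must stay `1`), `c_m·|T₁^{(k)}|` above
  let c : ℕ → ℝ := fun k => if k = 0 then 0 else cm * S.sites k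
  have hc_le : ∀ k, c k ≤ cm * S.sites k := fun k => by
    by_cases hk : k = 0
    · simp only [c, if_pos hk]; exact mul_nonneg hcm (sites_nonneg S k)
    · simp only [c, if_neg hk]; exact le_rfl
  -- the history's Z-budget `Σ_{j<k} a_j·|Z_j(h)|`
  let z : (k : ℕ) → Hist S.P k → ℝ := fun k h => ∑ j ∈ Finset.range k, a j * (ZVol D.M₁ D.Rcol k h j : ℝ)
  have hz_zero : ∀ h : Hist S.P 0, z 0 h = 0 := fun h => by simp only [z, Finset.range_zero, Finset.sum_empty]
  -- the CAPPED masses `e^{−c k − z k h}·m_k(h,·)` (zero beyond the run)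
  let W' : HistWeights S.P G :=
    { mass := fun k h U => if k ≤ S.K then Real.exp (-(c k + z k h)) * D.W.mass k h U else 0
      mass_nonneg := fun k h U => by
        by_cases hk : k ≤ S.K
        · rw [if_pos hk]; exact mul_nonneg (Real.exp_pos _).le (D.W.mass_nonneg k h U)
        · rw [if_neg hk]
      mass_le_one := fun k h U => by
        by_cases hk : k ≤ S.K
        · rw [if_pos hk]
          by_cases hk0 : k = 0
          · subst hk0
            rw [hz_zero h]
            simp only [c, if_true, add_zero, neg_zero, Real.exp_zero, one_mul, D.W.mass_zero]
            exact le_rfl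
          · have h1 : 1 ≤ k := Nat.one_le_iff_ne_zero.mpr hk0
            simp only [c, if_neg hk0]
            calc Real.exp (-(cm * S.sites k + z k h)) * D.W.mass k h U
                ≤ Real.exp (-(cm * S.sites k + z k h)) * Real.exp (cm * S.sites k + z k h) :=
                  mul_le_mul_of_nonneg_left (hmass k h1 hk h U) (Real.exp_pos _).le
              _ = 1 := by rw [← Real.exp_add, neg_add_cancel, Real.exp_zero]
        · rw [if_neg hk]; exact zero_le_one
      mass_zero := fun h U => by
        show (if 0 ≤ S.K then Real.exp (-(c 0 + z 0 h)) * D.W.mass 0 h U else 0) = 1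
        rw [if_pos (Nat.zero_le _), hz_zero h]
        simp only [c, if_true, add_zero, neg_zero, Real.exp_zero, one_mul, D.W.mass_zero] }
  -- the std tower input over the SAME averaging, minimisers, regions, remainder coefficients, WITH THE SHIFTED Z-COEFFICIENTS `zcoef_j + a_j`
  let D' : TowerInput S G :=
    { ε₁ := D.ε₁, av := D.av, avgAC := D.avgAC, reg := D.reg, Uk := D.Uk, lower := D.lower, upper := D.upper,
      lower_nonneg := D.lower_nonneg, upper_nonneg := D.upper_nonneg, M₁ := D.M₁, Rcol := D.Rcol, b₀ := D.b₀, p₀ := D.p₀, κ₀ := D.κ₀,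
      W := W', UkH := D.UkH, UkH_triv := D.UkH_triv, Pint := D.Pint, zcoef := fun j => D.zcoef j + a j, rcoef := D.rcoef, Estep := D.Estep }
  have hW' : ∀ (k : ℕ) (h : Hist S.P k) (U : GaugeField S.P k G), ¬ Hist.Admissible D'.M₁ D'.Rcol k h → D'.W.mass k h U = 0 := by
    intro k h U hh
    show (if k ≤ S.K then Real.exp (-(c k + z k h)) * D.W.mass k h U else 0) = 0
    by_cases hk : k ≤ S.K
    · rw [if_pos hk, hW k h U hh, mul_zero]
    · rw [if_neg hk]
  have hz0' : ∀ j, j < S.K → 0 ≤ D'.zcoef j := fun j hj => add_nonneg (hz0 j hj) (ha j)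
  have hz' : ∀ j, j < S.K → D'.zcoef j ≤ A * xlog (S.gk j) := fun j hj => hz j hj
  have h' := lf_tower3_avg 𝔊 C hd hCL hL D' hsites hW' hε hC₁ hb₀ hp₀ hrun hγ hLF67 h68 hM hRcol hρ hr hRle hz0' hz' hA hg hgs hp hb₁ hb₂
  intro k hk U
  have hkK : k ≤ S.K := hk
  -- the functional of the capped-and-shifted input at ITS OWN Z-terms is the scaled functional of `D` at `D`'s Z-terms: the history parts cancel
  have hkey : D'.tower3.toTowerRun.LF k U (fun h => -(D'.tower3.toTowerRun.mainT k h U) + D'.tower3.toTowerRun.Zterm k h) =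
      Real.exp (-(c k)) * D.tower3.toTowerRun.LF k U (fun h => -(D.tower3.toTowerRun.mainT k h U) + D.tower3.toTowerRun.Zterm k h) := by
    show Carriers.LF W' k U (fun h => -(D.tower3.toTowerRun.mainT k h U) + ∑ j ∈ Finset.range k, (D.zcoef j + a j) * (ZVol D.M₁ D.Rcol k h j : ℝ)) =
      Real.exp (-(c k)) * LFAC D.W k U (fun h => -(D.tower3.toTowerRun.mainT k h U) + ∑ j ∈ Finset.range k, D.zcoef j * (ZVol D.M₁ D.Rcol k h j : ℝ))
    unfold Carriers.LF LFAC
    rw [Finset.mul_sum]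
    refine Finset.sum_congr rfl fun h _ => ?_
    show (if k ≤ S.K then Real.exp (-(c k + z k h)) * D.W.mass k h U else 0) * _ = _
    rw [if_pos hkK]
    beta_reduce
    have hsplit : ∑ j ∈ Finset.range k, (D.zcoef j + a j) * (ZVol D.M₁ D.Rcol k h j : ℝ) =
        ∑ j ∈ Finset.range k, D.zcoef j * (ZVol D.M₁ D.Rcol k h j : ℝ) + z k h := by
      simp only [z, ← Finset.sum_add_distrib, add_mul]
    rw [hsplit]
    have hE : Real.exp (-(c k + z k h)) *
        Real.exp (-(D.tower3.toTowerRun.mainT k h U) + (∑ j ∈ Finset.range k, D.zcoef j * (ZVol D.M₁ D.Rcol k h j : ℝ) + z k h)) =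
        Real.exp (-(c k)) * Real.exp (-(D.tower3.toTowerRun.mainT k h U) + ∑ j ∈ Finset.range k, D.zcoef j * (ZVol D.M₁ D.Rcol k h j : ℝ)) := by
      rw [← Real.exp_add, ← Real.exp_add]
      congr 1
      ring
    calc Real.exp (-(c k + z k h)) * D.W.mass k h U *
          Real.exp (-(D.tower3.toTowerRun.mainT k h U) + (∑ j ∈ Finset.range k, D.zcoef j * (ZVol D.M₁ D.Rcol k h j : ℝ) + z k h))
        = D.W.mass k h U * (Real.exp (-(c k + z k h)) *
            Real.exp (-(D.tower3.toTowerRun.mainT k h U) + (∑ j ∈ Finset.range k, D.zcoef j * (ZVol D.M₁ D.Rcol k h j : ℝ) + z k h))) := by ring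
      _ = D.W.mass k h U * (Real.exp (-(c k)) *
            Real.exp (-(D.tower3.toTowerRun.mainT k h U) + ∑ j ∈ Finset.range k, D.zcoef j * (ZVol D.M₁ D.Rcol k h j : ℝ))) := by rw [hE]
      _ = Real.exp (-(c k)) * (D.W.mass k h U *
            Real.exp (-(D.tower3.toTowerRun.mainT k h U) + ∑ j ∈ Finset.range k, D.zcoef j * (ZVol D.M₁ D.Rcol k h j : ℝ))) := by ring
  have h1 := h' k hk U
  rw [hkey] at h1
  have hexp : Real.exp (c k) * Real.exp (C.d * D.tower3.toTowerRun.sites k) ≤ Real.exp ((C.d + cm) * D.tower3.toTowerRun.sites k) := by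
    rw [← Real.exp_add]
    apply Real.exp_le_exp.mpr
    show c k + C.d * S.sites k ≤ (C.d + cm) * S.sites k
    have := hc_le k
    linarith
  calc D.tower3.toTowerRun.LF k U (fun h => -(D.tower3.toTowerRun.mainT k h U) + D.tower3.toTowerRun.Zterm k h)
      = Real.exp (c k) * (Real.exp (-(c k)) *
          D.tower3.toTowerRun.LF k U (fun h => -(D.tower3.toTowerRun.mainT k h U) + D.tower3.toTowerRun.Zterm k h)) := by
        rw [← mul_assoc, ← Real.exp_add, add_neg_cancel, Real.exp_zero, one_mul]
    _ ≤ Real.exp (c k) * Real.exp (C.d * D'.tower3.toTowerRun.sites k) := mul_le_mul_of_nonneg_left h1 (Real.exp_pos _).le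
    _ ≤ Real.exp ((C.d + cm) * D.tower3.toTowerRun.sites k) := hexp

/-- ★ **COROLLARY — THE HISTORY-EXTENSIVE LETTER WITH A CONSTANT BUDGET**: the same with `a_j ≡ a` (`0 ≤ a`, `zcoef_j + a ≤ A·x(g_j)` for `j < K`), the mass bound reading
`m_k(h,U) ≤ exp(c_m|T₁^{(k)}| + a·Σ_{j<k}|Z_j(h)|)`. [cite: Balaban1985UV3, pp.273–274 + (41) p.266] -/
theorem lf_towerAC3_of_massBoundZ_const (𝔊 : GroupModel G) (C : B10Assembly.Consts) (hd : C.d = 6 / Real.log C.L) (hCL : C.L = (L : ℝ))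
    (hL : 2 ≤ L) (D : TowerInputAC S G) {ρ' r₀ A gs ε C₁ cm a : ℝ}
    (hsites : ∀ k, k ≤ S.K → S.sites k = (Fintype.card (Site S.P k) : ℝ))
    (hW : ∀ (k : ℕ) (h : Hist S.P k) (U : GaugeField S.P k G), ¬ Hist.Admissible D.M₁ D.Rcol k h → D.W.mass k h U = 0)
    (hcm : 0 ≤ cm) (ha : 0 ≤ a)
    (hmass : ∀ k, 1 ≤ k → k ≤ S.K → ∀ (h : Hist S.P k) (U : GaugeField S.P k G),
      D.W.mass k h U ≤ Real.exp (cm * S.sites k + a * ∑ j ∈ Finset.range k, (ZVol D.M₁ D.Rcol k h j : ℝ)))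
    (hε : 0 < ε) (hC₁ : 0 < C₁) (hb₀ : 0 < D.b₀) (hp₀ : 0 < D.p₀)
    (hrun : ∀ j, S.gk j = B10.gRun C.g C.L ε j)
    (hγ : ∀ j, j < S.K → S.gk j ≤ gamma71L C₁ L D.b₀ D.p₀)
    (hLF67 : ∀ k, k ≤ S.K → ∀ (h : Hist S.P k), Hist.Admissible D.M₁ D.Rcol k h → ∀ (U : GaugeField S.P k G),
      ∀ e ∈ Hist.disc h, S.gk e.1 * B10.pFun D.b₀ D.p₀ (S.gk e.1) ≤
        ‖((hol (avgIter L (liftCfg 𝔊 (D.UkH k h U)) e.1) (codeZ e) (plaqWord e.2.2.1 e.2.2.2) :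
            (Matrix (Fin 𝔊.N) (Fin 𝔊.N) ℂ)ˣ) : Matrix (Fin 𝔊.N) (Fin 𝔊.N) ℂ) - 1‖)
    (h68 : ∀ k, k ≤ S.K → ∀ (h : Hist S.P k), Hist.Admissible D.M₁ D.Rcol k h → ∀ (U : GaugeField S.P k G),
      ∀ e ∈ Hist.disc h,
        pdevOn (loK L e.1 (codeZ e)) (plaqHiK L e.1 (codeZ e) e.2.2.1 e.2.2.2) (liftCfg 𝔊 (D.UkH k h U)) <
          C₁ * (S.gk e.1 * B10.pFun D.b₀ D.p₀ (S.gk e.1)) * (((L : ℝ) ^ e.1)⁻¹) ^ 2)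
    (hM : 0 < D.M₁) (hRcol : ∀ i j, i ≤ j → j ≤ S.K → D.Rcol j ≤ D.Rcol i) (hρ : 0 ≤ ρ') (hr : 0 ≤ r₀)
    (hRle : ∀ i, i ≤ S.K → (D.Rcol i : ℝ) ≤ ρ' * xlog (S.gk i) ^ r₀)
    (hz0 : ∀ j, j < S.K → 0 ≤ D.zcoef j) (hz : ∀ j, j < S.K → D.zcoef j + a ≤ A * xlog (S.gk j))
    (hA : 0 ≤ A)
    (hg : ∀ j, j ≤ S.K → 0 < S.gk j ∧ S.gk j ≤ gs) (hgs : gs ≤ 1)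
    (hp : r₀ * 3 + 2 ≤ 2 * D.p₀)
    (hb₁ : 8 * (A * (2 * (2 * ρ' + 2 * ((L : ℝ) * (3 * ((D.M₁ : ℝ) - 1)) + 3 * ((L : ℝ) - 1)) + 20) * 1) ^ 3 /
      (Real.log C.L / 2)) ≤ 1 / (4 * (𝔊.N : ℝ)) * D.b₀ ^ 2)
    (hb₂ : 56 ≤ 1 / (4 * (𝔊.N : ℝ)) * D.b₀ ^ 2) :
    ∀ k, k ≤ D.tower3.toTowerRun.K → ∀ U : D.tower3.toTowerRun.Cfg k,
      D.tower3.toTowerRun.LF k U (fun h => -(D.tower3.toTowerRun.mainT k h U) + D.tower3.toTowerRun.Zterm k h) ≤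
        Real.exp ((C.d + cm) * D.tower3.toTowerRun.sites k) :=
  lf_towerAC3_of_massBoundZ 𝔊 C hd hCL hL D (fun _ => a) hsites hW hcm (fun _ => ha)
    (fun k hk1 hkK h U => by rw [← Finset.mul_sum]; exact hmass k hk1 hkK h U)
    hε hC₁ hb₀ hp₀ hrun hγ hLF67 h68 hM hRcol hρ hr hRle hz0 hz hA hg hgs hp hb₁ hb₂

end Generic

/-! ## §2 The record's booking has the budget: `zcoef_j + d(𝔤)·c₁ ≤ A·x(g_j)` -/
section Slack

/-- ★★ **THE BOOKED Z-COEFFICIENT PLUS `d(𝔤)·c₁` IS STILL AT MOST `A·x(g_j)`**: with `CZ_j = (Cz + Cv)·g_j + C₅ + C₆ + (|log σ₀| + d(𝔤)·log g_j⁻¹)·c₁` (the lane's booking of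
print's «O(log g_j⁻¹)», `LargeFieldKnit.bookedCZ_le_xlog`) and `A = (Cz + Cv) + C₅ + C₆ + (|log σ₀| + d(𝔤))·c₁`, `0 < g_j ≤ 1`, nonnegative constants:
`CZ_j + d(𝔤)·c₁ ≤ A·x(g_j)`, `x(g) = 1 + log g⁻¹` — the difference is `(Cz + Cv)(1 − g_j) + [(Cz + Cv) + C₅ + C₆ + |log σ₀|c₁]·log g_j⁻¹ ≥ 0`.  Real arithmetic. [cite: Balaban1985UV3, (41) p.266] -/
theorem bookedCZ_add_le_xlog {Cz Cv C₅ C₆ σabs dg c₁ g : ℝ} (hCz : 0 ≤ Cz + Cv) (h5 : 0 ≤ C₅) (h6 : 0 ≤ C₆) (hσ : 0 ≤ σabs)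
    (hc₁ : 0 ≤ c₁) (hg1 : g ≤ 1) (hu : 0 ≤ Real.log g⁻¹) :
    (Cz + Cv) * g + C₅ + C₆ + (σabs + dg * Real.log g⁻¹) * c₁ + dg * c₁ ≤
      ((Cz + Cv) + C₅ + C₆ + (σabs + dg) * c₁) * xlog g := by
  have hx : xlog g = 1 + Real.log g⁻¹ := rfl
  rw [hx]
  nlinarith [mul_nonneg hCz hu, mul_nonneg h5 hu, mul_nonneg h6 hu, mul_nonneg (mul_nonneg hσ hc₁) hu, mul_nonneg hCz (sub_nonneg.2 hg1)]

/-- **THE WHOLE SLACK, DISPLAYED**: `A·x(g) − CZ = (Cz + Cv)(1 − g) + d(𝔤)·c₁ + [(Cz + Cv) + C₅ + C₆ + |log σ₀|·c₁]·log g⁻¹` (an identity of real numbers; the slack is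
`≥ d(𝔤)·c₁` and grows like `log g⁻¹` at fine levels). [cite: Balaban1985UV3, (41) p.266] -/
theorem bookedCZ_slack_eq (Cz Cv C₅ C₆ σabs dg c₁ g : ℝ) :
    ((Cz + Cv) + C₅ + C₆ + (σabs + dg) * c₁) * xlog g - ((Cz + Cv) * g + C₅ + C₆ + (σabs + dg * Real.log g⁻¹) * c₁) =
      (Cz + Cv) * (1 - g) + dg * c₁ + ((Cz + Cv) + C₅ + C₆ + σabs * c₁) * Real.log g⁻¹ := by
  have hx : xlog g = 1 + Real.log g⁻¹ := rfl
  rw [hx]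
  ring

variable {L : ℕ} (S : Scales L)

/-- ★★ **THE RECORD'S BOOKING HAS THE BUDGET `d(𝔤)·c₁` AT EVERY LEVEL**: for the lane's booked Z-coefficients `Carriers.zcoefOf S K j` on the window (`0 < g_j ≤ 1` for `j < K`):
`zcoefOf S K j + K.dg·K.c₁ ≤ ((K.Cz + K.Cv) + K.C₅ + K.C₆ + (|K.logσ₀| + K.dg)·K.c₁)·x(g_j)` — `LargeFieldStd.zcoefOf_le` with the budget added; so §1 applies at the lane's tower with
`a_j := K.dg·K.c₁` and the SAME rate constant `A`, i.e. the same provisos. [cite: Balaban1985UV3, (41) p.266] -/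
theorem zcoefOf_add_le (K : CarrierConsts) (hCz : 0 ≤ K.Cz + K.Cv) (h5 : 0 ≤ K.C₅) (h6 : 0 ≤ K.C₆) (hc₁ : 0 ≤ K.c₁) :
    ∀ j, j < S.K → zcoefOf S K j + K.dg * K.c₁ ≤ ((K.Cz + K.Cv) + K.C₅ + K.C₆ + (|K.logσ₀| + K.dg) * K.c₁) * xlog (S.gk j) := by
  intro j hj
  unfold zcoefOf
  exact bookedCZ_add_le_xlog hCz h5 h6 (abs_nonneg _) hc₁ (gk_le_one S S.gK_le_one j hj.le)
    (B10.log_inv_nonneg_of_le_one (gk_pos S j) (gk_le_one S S.gK_le_one j hj.le))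

/-- The budget is nonnegative: `0 ≤ K.dg·K.c₁` for `c₁ ≥ 0` (`K.dg = d(𝔤) ≥ 0` is a field of the carrier constants). [folklore] -/
theorem budget_nonneg (K : CarrierConsts) (hc₁ : 0 ≤ K.c₁) : 0 ≤ K.dg * K.c₁ := mul_nonneg K.dg_nonneg hc₁

/-- The displayed slack at the record's booking: `A·x(g_j) − zcoefOf S K j = (Cz + Cv)(1 − g_j) + d(𝔤)c₁ + [(Cz + Cv) + C₅ + C₆ + |log σ₀|c₁]·log g_j⁻¹`. [cite: Balaban1985UV3, (41) p.266] -/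
theorem zcoefOf_slack_eq (K : CarrierConsts) (j : ℕ) :
    ((K.Cz + K.Cv) + K.C₅ + K.C₆ + (|K.logσ₀| + K.dg) * K.c₁) * xlog (S.gk j) - zcoefOf S K j =
      (K.Cz + K.Cv) * (1 - S.gk j) + K.dg * K.c₁ + ((K.Cz + K.Cv) + K.C₅ + K.C₆ + |K.logσ₀| * K.c₁) * Real.log (S.gk j)⁻¹ := by
  unfold zcoefOf
  exact bookedCZ_slack_eq _ _ _ _ _ _ _ _

end Slack

/-! ## §3 Row B25 at the lane's AC tower from the (α)-AC rows and the history-extensive bound with the record's budget `d(𝔤)·c₁` -/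
section Lane

variable {L : ℕ} {S : Scales L} {G : Type} [GaugeGroup G] [MeasurableSpace G] [HaarData G] {𝔊 : GroupModel G} {𝔠 : Primitives.AlphaConsts L 𝔊.N}
  {X : ExternalInputsAC S G} {𝔖 : ∀ k, StepSeries S G ↥(lieC 𝔊) (nblkOf S 𝔠.lane.carrier k) k} {𝔄 : AlphaDataAC 𝔊 𝔠 X 𝔖}
  (hle : S.g ^ 2 * S.ε₀ ≤ (min 𝔠.gamma0 1) ^ 2)
include hle

/-- ★★ **ROW B25 AT THE LANE'S AC TOWER `towerOfAC 𝔠.lane X 𝔖` FROM THE (α)-AC ROWS AND THE HISTORY-EXTENSIVE MASS BOUND WITH THE RECORD'S BUDGET**, on the `≤`-family: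
(α) rows `hLF67`∕`h68` of `RunAlphaAC`; the bound «`m_k(h,U) ≤ exp(c_m|T₁^{(k)}| + d(𝔤)c₁·Σ_{j<k}|Z_j(h)|)`, `1 ≤ k ≤ K`» on the lane's own masses; EVERY hypothesis about the lane's
DEFINITIONS discharged exactly as in file 15 §2 — collar profile `rcolOf`, Z-coefficients `zcoefOf` WITH THE BUDGET (`zcoefOf_add_le`), masses off admissible histories,
`|T₁^{(k)}| = #T^{(k)}`, `g_k = gRun 1 L (g²ε) k`, and the provisos R-E2′ OF RECORD (`prov_hb₁`, `prov_hb₂` at the record's `A`, `b₀` — unchanged). [cite: Balaban1985UV3, pp.273–274 + (67)–(68) p.273 + (39)–(41) p.266 + (7) p.257] -/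
theorem lf_towerOfAC_of_alphaAC_of_massBoundZ (R : RunAlphaAC 𝔊 𝔠 X 𝔖 𝔄) {cm : ℝ} (hcm : 0 ≤ cm)
    (hmass : ∀ k, 1 ≤ k → k ≤ S.K → ∀ (h : Hist S.P k) (U : GaugeField S.P k G),
      (inputOfAC 𝔠.lane X 𝔖).W.mass k h U ≤
        Real.exp (cm * S.sites k + 𝔠.lane.carrier.dg * 𝔠.lane.carrier.c₁ *
          ∑ j ∈ Finset.range k, (ZVol 𝔠.lane.carrier.M₁ (rcolOf S 𝔠.lane.carrier) k h j : ℝ))) :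
    ∀ k, k ≤ (towerOfAC 𝔠.lane X 𝔖).K → ∀ U : (towerOfAC 𝔠.lane X 𝔖).Cfg k,
      (towerOfAC 𝔠.lane X 𝔖).LF k U (fun h => -((towerOfAC 𝔠.lane X 𝔖).mainT k h U) + (towerOfAC 𝔠.lane X 𝔖).Zterm k h)
        ≤ Real.exp ((𝔠.lane.consts.d + cm) * (towerOfAC 𝔠.lane X 𝔖).sites k) := by
  have hr₀ : 0 ≤ 𝔠.lane.carrier.r₀ := le_trans zero_le_one 𝔠.one_le_r₀
  have hCz : 0 ≤ 𝔠.lane.carrier.Cz + 𝔠.lane.carrier.Cv := add_nonneg 𝔠.Cz_nonneg 𝔠.Cv_nonneg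
  have hc₁ : 0 ≤ 𝔠.lane.carrier.c₁ := by show (0 : ℝ) ≤ 3; norm_num
  have hA : 0 ≤ (𝔠.lane.carrier.Cz + 𝔠.lane.carrier.Cv) + 𝔠.lane.carrier.C₅ + 𝔠.lane.carrier.C₆ +
      (|𝔠.lane.carrier.logσ₀| + 𝔠.lane.carrier.dg) * 𝔠.lane.carrier.c₁ := by
    have := 𝔠.lane.carrier.dg_nonneg
    have := abs_nonneg 𝔠.lane.carrier.logσ₀
    have h5 : 0 ≤ 𝔠.lane.carrier.C₅ := 𝔠.C₅_nonneg
    have h6 : 0 ≤ 𝔠.lane.carrier.C₆ := 𝔠.C₆_nonneg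
    positivity
  have hρ : (0 : ℝ) ≤ (𝔠.lane.carrier.R₁ + 1) * 𝔠.lane.carrier.M₁ := by
    have : 0 ≤ 𝔠.lane.carrier.R₁ := 𝔠.R₁_nonneg
    positivity
  exact lf_towerAC3_of_massBoundZ_const 𝔊 𝔠.lane.consts (consts3_d_eq_log 𝔠.lane.F 𝔠.lane.sc) rfl S.hL.2 (inputOfAC 𝔠.lane X 𝔖) (gs := 1) (ε := S.g0sq)
    (fun k hk => by exact_mod_cast sites_eq_card S k (by omega))
    (fun k h U hh => StandardAC.stdTowerInputAC_mass_eq_zero_of_not_admissible X 𝔠.lane.carrier 𝔖 k h U hh)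
    hcm (budget_nonneg 𝔠.lane.carrier hc₁) hmass (g0sq_pos S) 𝔠.C68_pos 𝔠.lane.F.b₀_pos 𝔠.lane.F.p₀_pos
    (fun j => by rw [show 𝔠.lane.consts.g = 1 from rfl, show 𝔠.lane.consts.L = (L : ℝ) from rfl]; exact gk_eq_gRun_norm S j)
    (fun j hj => (thresholds_of_le hle j hj.le).2.2.2.1) R.hLF67 R.h68 𝔠.lane.F.M₁_pos
    (LargeFieldStd.rcolOf_antitone 𝔠.lane.carrier 𝔠.R₁_nonneg hr₀) hρ hr₀ (LargeFieldStd.rcolOf_le 𝔠.lane.carrier 𝔠.R₁_nonneg hr₀)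
    (LargeFieldStd.zcoefOf_nonneg 𝔠.lane.carrier hCz 𝔠.C₅_nonneg 𝔠.C₆_nonneg hc₁)
    (zcoefOf_add_le S 𝔠.lane.carrier hCz 𝔠.C₅_nonneg 𝔠.C₆_nonneg hc₁) hA
    (fun j hj => ⟨gk_pos S j, gk_le_one S S.gK_le_one j hj⟩) le_rfl 𝔠.prov_r₀p₀ (prov_hb₁ 𝔠 𝔊.N_pos) (prov_hb₂ 𝔠 𝔊.N_pos)

end Lane

end Summit.QuantumFields.YangMills.BalabanUVNodes.N08LargeFieldRowZBudget

end
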